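import Summits.BirchSwinnertonDyer.BirchSwinnertonDyer.Theorems.ByReductionTypeAtTwoEulerCharFormalLower
import Summits.BirchSwinnertonDyer.BirchSwinnertonDyer.Theorems.ByReductionTypeAtTwoEulerCharFormalHTwoAtTwo
import Summits.BirchSwinnertonDyer.BirchSwinnertonDyer.Theorems.ByReductionTypeAtTwoEulerCharLayerZero
import Summits.BirchSwinnertonDyer.BirchSwinnertonDyer.Theorems.ByReductionTypeAtTwoTowerClassKit
import HarnessLib

/-!
# Route `ByReductionTypeAtTwo` (K4), TOWER road — Greenberg's Theorem 4.1 at `p = 2` in the KERNEL for `a₂ = 1`: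
# `TwoAdicEulerCharRankZero W 0` for `W/ℚ` good ordinary at `2` with `#Ẽ(𝔽₂) = 2` and `E(ℚ)[2] = 0`

Cell `bsd-2adic`, seat `bsd-2adic-tower-1` (GEN 25), `--supports stmt-BirchSwinnertonDyer-19271` (helper). TOOL theorems only
(no definition, no named fact, no `sorry`); closes nothing by itself; BSD is not proved by any of this.

The end of the programme «Greenberg LNM 1716 Lemma 3.4 at layer `0` EXACT ⇒ Thm. 4.1 over `ℚ` ⇒ the `hEC` binder of the
TOWER doors in the kernel» (files `…EulerCharLayerZero/CoinvExact/CoinvInput/Devissage/ReductionCount/Assembly/FormalBound/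
FormalKummer/FormalLower/FormalHTwoAtTwo.lean`) on the half `a₂(E) = 1` (`#Ẽ(𝔽₂) = 2`) of the good ordinary curves at `2`:

* `natCard_localTowerKerPrimary_zero_eq_sq_two_of_reductionPointCount` — **Lemma 3.4 at layer `0`, EXACT, at `p = 2` with
  `#Ẽ(𝔽₂) = 2`**: `#𝒦_{v,0}[2^∞] = (2^{ord₂ #Ẽ(𝔽₂)})² = 4`. Lower bound: `2 ≤ #H²(Γ_{ℚ_v}, Ê[2])` (`…FormalHTwoAtTwo`)
  `≤ #(Ê(𝔪_∞)/(g−1))[2^∞]` (`…FormalLower`); upper bound and assembly: `…FormalBound`.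
* `twoAdicEulerCharRankZero_of_reductionPointCount_two` — **the PRINT binder `hEC : TwoAdicEulerCharRankZero W 0` of the 852
  `TowerClass<label>` doors is a THEOREM** for `W` with good ordinary reduction at `2`, `#Ẽ(𝔽₂) = 2` and no rational
  `2`-torsion (`twoAdicEulerCharRankZero_of_layerZeroCount`); `…_of_irr` — the same on the `Irr W 2` rows.

What remains PRINT for the other half (`a₂ = −1`, `#Ẽ(𝔽₂) = 4`): the depth-2 local count `4 ≤ #H²(Γ_{ℚ_v}, Ê[4])` (the
Weil pairing on the ordinary line: `Hom_Γ(Ê[4], μ₄) ≅ Ẽ[4](𝔽₂)`), after which `…FormalLower` and `…FormalBound` give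
Lemma 3.4 at layer `0` and this file's argument gives `hEC` verbatim.

References: [GreenbergLNM1716] §3 Lemma 3.4 (p. 89), §4 Thm. 4.1 (pp. 94–98); [CoatesGreenberg1996] Cor. 3.2;
[MilneADT2006] I Thm. 2.8, Cor. 2.3.
-/

set_option autoImplicit false
-- the Theorems namespace of this sub repeats the summit name by design (D-0017 nested layout: Summit.<S>.<Sub>)
set_option linter.dupNamespace false

noncomputable section

open scoped Classical NNReal

universe u

namespace Summit.BirchSwinnertonDyer.BirchSwinnertonDyer.Theorems.GoodOrdTower

open NumberField IsDedekindDomain Field _root_.ContinuousCohomology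
  Literature.NumberTheory.EllipticCurves Literature.NumberTheory.GaloisRepresentations IsDedekindDomain.HeightOneSpectrum
  Literature.NumberTheory.EllipticCurves.FormalGroupChart Literature.NumberTheory.EllipticCurves.ResKernel
  Literature.NumberTheory.EllipticCurves.Rank1Residual WeierstrassCurve Rat.HeightOneSpectrum

set_option maxHeartbeats 6400000 in
/-- **Greenberg's Lemma 3.4 at layer `0`, EXACT, at `p = 2` when `#Ẽ(𝔽₂) = 2`**: for `W/ℚ` globally minimal and elliptic
with `GoodOrd W 2` and `W.reductionPointCount 2 = 2`, `κ` the cyclotomic `ℤ₂`-extension and `v ∋ 2`,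
`#𝒦_{v,0}[2^∞] = (2^{ord₂ #Ẽ(𝔽₂)})²`. The package of `…EulerCharFormalBound` §4, the depth-1 lower bound
`2 ≤ #H²(Γ_{ℚ_v}, Ê[2]) ≤ #(M₁/(g−1)M₁)[2^∞]` (`two_le_natCard_H2_formalTorsion_two`, `natCard_H2_formalTorsion_le_formalCoinv`) and
`natCard_localTowerKerPrimary_zero_eq_sq_two_of_formalCountGe`. [cite: GreenbergLNM1716, §3 Lemma 3.4 (p. 89)] -/
theorem natCard_localTowerKerPrimary_zero_eq_sq_two_of_reductionPointCount {κ : ZpExtension ℚ 2} (hκ : κ.IsCyclotomic)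
    (v : HeightOneSpectrum (𝓞 ℚ)) (hpv : ((2 : ℕ) : 𝓞 ℚ) ∈ v.asIdeal) (W : WeierstrassCurve ℚ) [W.IsGloballyMinimal]
    [W.IsElliptic] (hgo : GoodOrd W 2) (hN : W.reductionPointCount 2 = 2) :
    Nat.card (W.localTowerKerPrimary κ (v.adicCompletion ℚ) 0) = (2 ^ padicValNat 2 (W.reductionPointCount 2)) ^ 2 := by
  haveI hp : Fact (Nat.Prime 2) := ⟨Nat.prime_two⟩
  have hord : W.HasGoodReductionAtPrime 2 ∧ ¬ ((2 : ℕ) : ℤ) ∣ W.frobeniusTrace 2 := hgo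
  have hΔ : ¬ ((2 : ℕ) : ℤ) ∣ minimalDiscriminantInt W :=
    W.not_dvd_minimalDiscriminantInt_of_hasGoodReductionAtPrime' 2 hord.1
  obtain ⟨w, hw⟩ := v.exists_spectralValuation
  have hvO : w.Integers w.valuationSubring := Valuation.valuationSubring.integers w
  have hΔu := W.isUnit_Δ_localIntModel hpv hw hΔ
  let red₀ : localPoints W (v.adicCompletion ℚ) →+
      (((integralModelInt W).map (algebraMap ℤ ↥w.valuationSubring)).map
        (IsLocalRing.residue ↥w.valuationSubring)).toAffine.Point :=
    (goodReductionHom _ hvO hΔu).comp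
      (Affine.Point.congrEquiv (localIntModel_baseChange W w.valuationSubring).symm).toAddMonoidHom
  have hred₀ : ∀ P : localPoints W (v.adicCompletion ℚ), red₀ P =
      ((integralModelInt W).map (algebraMap ℤ ↥w.valuationSubring)).reducePoint
        (Affine.Point.congrEquiv (localIntModel_baseChange W w.valuationSubring).symm P) :=
    fun P ↦ rfl
  have hstab : ∀ (σ : absoluteGaloisGroup (v.adicCompletion ℚ)) (Q : localPoints W (v.adicCompletion ℚ)),
      red₀ Q = 0 → red₀ (σ • Q) = 0 :=
    fun σ Q hQ ↦ (W.localRed_smul_eq_zero_iff hw hΔu red₀ hred₀ σ Q).mpr hQ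
  have hkst : ∀ (σ : absoluteGaloisGroup (v.adicCompletion ℚ)) (a : (localPoints W (v.adicCompletion ℚ))), a ∈ red₀.ker → σ • a ∈ red₀.ker :=
    fun σ a ha ↦ (AddMonoidHom.mem_ker).mpr (hstab σ a ((AddMonoidHom.mem_ker).mp ha))
  -- layer `0`: an inertial topological generator `g`, `M₁ = A₁^{H_∞}`, `D₁ = g − 1`
  obtain ⟨g, hgI, -, hgen⟩ := exists_inertial_generator hκ v hpv 0
  let M₁s : AddSubgroup (localPoints W (v.adicCompletion ℚ)) := red₀.ker ⊓ FixedPoints.addSubgroup (localSubgroup κ.kerSubgroup (v.adicCompletion ℚ)) (localPoints W (v.adicCompletion ℚ))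
  have hM₁s : ∀ a, a ∈ M₁s ↔ a ∈ red₀.ker ∧ ∀ h ∈ (localSubgroup κ.kerSubgroup (v.adicCompletion ℚ)), h • a = a := fun a ↦ by
    change a ∈ red₀.ker ⊓ FixedPoints.addSubgroup (localSubgroup κ.kerSubgroup (v.adicCompletion ℚ)) (localPoints W (v.adicCompletion ℚ)) ↔ _
    rw [AddSubgroup.mem_inf, FixedPoints.mem_addSubgroup]
    exact ⟨fun ⟨h1, h2⟩ ↦ ⟨h1, fun σ hσ ↦ h2 ⟨σ, hσ⟩⟩, fun ⟨h1, h2⟩ ↦ ⟨h1, fun σ ↦ h2 σ σ.2⟩⟩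
  let D₁ : M₁s →+ M₁s :=
    { toFun := fun a ↦ ⟨g • (a : (localPoints W (v.adicCompletion ℚ))) - a, ⟨red₀.ker.sub_mem (hkst g a a.2.1) a.2.1,
        (subOne (localSubgroup κ.kerSubgroup (v.adicCompletion ℚ)) (localPoints W (v.adicCompletion ℚ)) g ⟨(a : (localPoints W (v.adicCompletion ℚ))), a.2.2⟩).2⟩⟩
      map_zero' := Subtype.ext (by simp)
      map_add' := fun a b ↦ Subtype.ext (by
        simp only [AddSubgroup.coe_add, smul_add]
        abel) }
  have hD₁ : ∀ a : M₁s, ((D₁ a : M₁s) : (localPoints W (v.adicCompletion ℚ))) = g • (a : (localPoints W (v.adicCompletion ℚ))) - a := fun _ ↦ rfl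
  -- the formal-group torsion `Z = Ê[2]` with its Galois action (as in `…GoodOrdTowerControlLayerFormalP`)
  let Zs : AddSubgroup (localPoints W (v.adicCompletion ℚ)) :=
    red₀.ker ⊓ AddSubgroup.torsionBy (localPoints W (v.adicCompletion ℚ)) ((2 ^ 1 : ℕ) : ℤ)
  have hZs : ∀ a : localPoints W (v.adicCompletion ℚ), a ∈ Zs ↔ red₀ a = 0 ∧ 2 ^ 1 • a = 0 := fun a ↦ by
    change a ∈ red₀.ker ⊓ AddSubgroup.torsionBy _ ((2 ^ 1 : ℕ) : ℤ) ↔ _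
    rw [AddSubgroup.mem_inf, AddMonoidHom.mem_ker]
    exact and_congr Iff.rfl AddSubgroup.torsionBy.nsmul_iff
  have hZstab : ∀ (σ : absoluteGaloisGroup (v.adicCompletion ℚ)) (a : localPoints W (v.adicCompletion ℚ)),
      a ∈ Zs → σ • a ∈ Zs := fun σ a ha ↦
    (hZs _).mpr ⟨hstab σ a ((hZs a).mp ha).1, by rw [smul_comm, ((hZs a).mp ha).2, smul_zero]⟩
  letI iSMul : SMul (absoluteGaloisGroup (v.adicCompletion ℚ)) Zs := ⟨fun σ z ↦ ⟨σ • (z : localPoints W (v.adicCompletion ℚ)), hZstab σ z z.2⟩⟩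
  have hsmul : ∀ (σ : absoluteGaloisGroup (v.adicCompletion ℚ)) (z : Zs),
      ((σ • z : Zs) : localPoints W (v.adicCompletion ℚ)) = σ • (z : localPoints W (v.adicCompletion ℚ)) := fun _ _ ↦ rfl
  letI iMA : MulAction (absoluteGaloisGroup (v.adicCompletion ℚ)) Zs :=
    { one_smul := fun z ↦ Subtype.ext (by rw [hsmul, one_smul])
      mul_smul := fun σ σ' z ↦ Subtype.ext (by rw [hsmul, hsmul, hsmul, mul_smul]) }
  letI iDMA : DistribMulAction (absoluteGaloisGroup (v.adicCompletion ℚ)) Zs :=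
    { smul_zero := fun σ ↦ Subtype.ext (by rw [hsmul, ZeroMemClass.coe_zero, smul_zero])
      smul_add := fun σ z z' ↦ Subtype.ext (by
        rw [hsmul, AddMemClass.coe_add, AddMemClass.coe_add, hsmul, hsmul, smul_add]) }
  let ρC : ContinuousRep (absoluteGaloisGroup (v.adicCompletion ℚ)) ℤ Zs :=
    ContinuousRep.ofStabilizerMemNhdsOne (Representation.ofDistribMulAction ℤ (absoluteGaloisGroup (v.adicCompletion ℚ)) Zs)
      fun z ↦ by
      have hopen' : IsOpen ((fun σ : absoluteGaloisGroup (v.adicCompletion ℚ) ↦ σ • (z : localPoints W (v.adicCompletion ℚ))) ⁻¹'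
          {(z : localPoints W (v.adicCompletion ℚ))}) :=
        (isOpen_discrete _).preimage (continuous_smul_localPoints W (v.adicCompletion ℚ) (z : localPoints W (v.adicCompletion ℚ)))
      refine Filter.mem_of_superset (hopen'.mem_nhds (by simp)) fun σ hσ ↦ ?_
      exact Subtype.ext hσ
  have hρC : ∀ (σ : absoluteGaloisGroup (v.adicCompletion ℚ)) (z : Zs),
      ((ρC σ z : Zs) : localPoints W (v.adicCompletion ℚ)) = σ • (z : localPoints W (v.adicCompletion ℚ)) := fun _ _ ↦ rfl
  -- the bounds
  have hg0 : g ∈ localSubgroup (κ.layerSubgroup 0) (v.adicCompletion ℚ) := by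
    rw [mem_localSubgroup_iff, ZpExtension.layerSubgroup_zero]; exact Subgroup.mem_top _
  haveI := (finite_primary_formalCoinv_and_natCard_le hκ v hpv W hgo hw red₀ hred₀ hg0 hgen M₁s hM₁s D₁ hD₁).1
  have h2 := (two_le_natCard_H2_formalTorsion_two v hpv W hgo hw red₀ hred₀ Zs hZs ρC).2
  have hH2 := (natCard_H2_formalTorsion_le_formalCoinv hκ v hpv W hgo hw red₀ hred₀ hgen M₁s hM₁s D₁ hD₁ 1 Zs hZs ρC hρC).2
  have hv2 : padicValNat 2 (W.reductionPointCount 2) = 1 := by rw [hN]; simp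
  refine natCard_localTowerKerPrimary_zero_eq_sq_two_of_formalCountGe hκ v hpv W hgo hw red₀ hred₀ hgI hgen M₁s hM₁s D₁
    hD₁ ?_
  rw [hv2, pow_one]
  exact h2.trans hH2

end Summit.BirchSwinnertonDyer.BirchSwinnertonDyer.Theorems.GoodOrdTower

namespace Summit.BirchSwinnertonDyer.BirchSwinnertonDyer.Theorems.GreenbergEulerChar

open NumberField Literature.NumberTheory.EllipticCurves.Rank1Residual Summit.BirchSwinnertonDyer.Rank1Residual.X5.O1
  WeierstrassCurve

/-- **`hEC` in the kernel for `a₂ = 1`: Greenberg's Theorem 4.1 at `p = 2`** — for `W/ℚ` globally minimal and elliptic with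
`#Ẽ(𝔽₂) = 2` and no rational `2`-torsion, the Euler-characteristic formula `TwoAdicEulerCharRankZero W 0` HOLDS (its own
hypotheses supply `GoodOrd W 2`, the cyclotomic `κ`, the Selmer-dual data and the finiteness of `Sel`): Lemma 3.4 at layer
`0` (`natCard_localTowerKerPrimary_zero_eq_sq_two_of_reductionPointCount`) fed to `twoAdicEulerCharRankZero_of_layerZeroCount`.
[cite: GreenbergLNM1716, §4 Thm. 4.1 (pp. 94–98); §3 Lemma 3.4 (p. 89)] -/
theorem twoAdicEulerCharRankZero_of_reductionPointCount_two (W : WeierstrassCurve ℚ) [W.IsElliptic] [W.IsGloballyMinimal]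
    (hN : W.reductionPointCount 2 = 2) (hK : ∀ P : W.toAffine.Point, 2 • P = 0 → P = 0) :
    TwoAdicEulerCharRankZero W 0 :=
  twoAdicEulerCharRankZero_of_layerZeroCount W hK fun hgo _ hκ v hv ↦
    GoodOrdTower.natCard_localTowerKerPrimary_zero_eq_sq_two_of_reductionPointCount hκ v hv W hgo hN

/-- **`hEC` in the kernel for `a₂ = 1`, torsion-order form**: `#Ẽ(𝔽₂) = 2` and `2 ∤ #E(ℚ)_tors` give
`TwoAdicEulerCharRankZero W 0`. [cite: GreenbergLNM1716, §4 Thm. 4.1 (pp. 94–98)] -/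
theorem twoAdicEulerCharRankZero_of_reductionPointCount_two_of_not_dvd_torsionOrder (W : WeierstrassCurve ℚ)
    [W.IsElliptic] [W.IsGloballyMinimal] (hN : W.reductionPointCount 2 = 2) (htors : ¬ 2 ∣ W.torsionOrder) :
    TwoAdicEulerCharRankZero W 0 :=
  -- (`convert` bridges the two `DecidableEq ℚ` instances behind the group law on `W.toAffine.Point`)
  twoAdicEulerCharRankZero_of_reductionPointCount_two W hN fun P hP ↦
    Rank1Residual.Iwasawa.forall_smul_eq_zero_imp_of_not_dvd_torsionOrder W htors P (by convert hP)

/-- **`hEC` in the kernel on the `Irr W 2` rows with `a₂ = 1`**: for `W/ℚ` globally minimal and elliptic with `E[2]`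
irreducible (`Irr W 2`, so no rational `2`-torsion: `TowerClass.not_two_dvd_torsionOrder_of_irr`) and `#Ẽ(𝔽₂) = 2`,
`TwoAdicEulerCharRankZero W 0` holds — the PRINT binder `hEC` of the `TowerClass<label>` doors
(`TowerClass.bsdp_two_of_towerGap_of_layerSelmer_of_irr`) discharged on these rows. [cite: GreenbergLNM1716, §4 Thm. 4.1] -/
theorem twoAdicEulerCharRankZero_of_irr_of_reductionPointCount_two (W : WeierstrassCurve ℚ) [W.IsElliptic]
    [W.IsGloballyMinimal] (hirr : Irr W 2) (hN : W.reductionPointCount 2 = 2) : TwoAdicEulerCharRankZero W 0 :=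
  twoAdicEulerCharRankZero_of_reductionPointCount_two_of_not_dvd_torsionOrder W hN
    (TowerClass.not_two_dvd_torsionOrder_of_irr W hirr)

end Summit.BirchSwinnertonDyer.BirchSwinnertonDyer.Theorems.GreenbergEulerChar

end
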